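import Literature.MathematicalPhysics.QuantumFieldTheory.Balaban1983to89.Beta.BalabanStepJetsSucc

/-!
# Adjointness of block-contour decimation and the averaging lift at the VERTEX and the HESSIAN-KERNEL level:
# the stencil-index swap for an `M`-contour-summed lifted stencil family, and `hessKer K (Q′ᵀVQ′) (Q′ᵀWQ′) = hessKer (Q′KQ′ᵀ) V W`
# (β sub-cell, an4 lineage; the kernel form of the (P6′) «UNITS numerals» arbiters (I1)–(I3) of COUNT X-an4-39)

HONEST FRAMING (page 1, verbatim programme rule).  Discharging `FlowStep.BetaPertH` would make Bałaban's ultraviolet stability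
UNCONDITIONAL — a real constructive-QFT result; it is NOT the continuum limit and NOT the Clay problem.  This file discharges NOTHING
of `BetaPertH` and asserts nothing about Bałaban's kernels or about the disputed weights: it is ELEMENTARY KERNEL CALCULUS
(re-indexed absolutely convergent lattice sums, block regrouping, Fubini under product majorants) over the sockets of
`Beta/ExpKernelCalculus`, `Beta/OneStepResolventKernel`, `Beta/OneStepKernelFamily`, `Beta/InterLevelTransport` and
`Beta/BalabanCompositeJets`.  Every declaration is [folklore]; 0 cited facts; 0 `def … : Prop`; no value of `d`, `Lc`; no weight is
chosen here (§5 reads `BalabanStepJetsSucc.wVH` by name).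

VERSIONS.  v1 (p193758, an4 lineage gen 24): §§1–4.  v1.1 (p193982, an4 lineage gen 24): + §5 (`avgLift_smul`, `vertexOfK_smul`,
`vertexOf_borderPiece_eq_step`, `bubble_borderPiece_eq_step`) once `BalabanStepJetsSucc` v1.2 (p193623) had introduced the (V-H) step
weight `wVH`; §§1–4 declarations byte-unchanged.  v1.2 (an4 lineage gen 25): + §6 END-TO-END BY NAME (`tstepOf_eq_lifted`,
`hessKer_KInv_lifted_eq_tstepOf`, `tbalOf_eq_hessKer_KInv_lifted`): (I2) meets the wall's step-kernel constructor
`OneStepKernelFamily.TstepOf` / `TbalOf` for ANY jet datum — the outside reader's END-TO-END trailer (XREAD C-lit2g21-6 of v1/v1.1,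
INFO I3) made importable; §§1–5 declarations byte-unchanged.

ABSOLUTE RULE (cell charter, verbatim): «No internally-minted statement may enter as a cited fact. Every hypothesis is either
kernel-proved in this package or a verbatim quotation of a PUBLISHED theorem with page reference. The manuscript(s) under audit are
NOT citable for their own disputed steps — they are the thing under adjudication; programme-internal (2001/route/tribunal) claims
are never citable.»  Nothing below is a hypothesis taken from print or from a programme record; the records named (COUNT X-an4-39,
WALL item (P6′), DESIGN (D-μ)) are LOCATORS for why these identities are wanted, never premises.

WHY.  The wall's remaining EXIT-B item (P6′) «UNITS numerals certified» (WALL v2.18; lead BINDER CHECK (n1)) asks for the scalar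
weights with which the three pieces of the step-`j` first-order stencil family (`Beta/BalabanStepJetsSucc` §5 `Sstep`) must be taken
so that the typed step kernel `OneStepKernelFamily.TstepOf Lc j` (covariance `KInvStep Lc j = dec (Lc^j) (KInv (Lc^{j+1}))`, vertices
`vertexOfK (KInvStep Lc j) Lc ·`) reproduces the level-`(j+1)` part of the one-shot kernel `OneStepResolventKernel.TOf (N := Lc^{j+1})`
of the composite jets (`BalabanCompositeJets.Sc`, whose level step carries `(cVH·M^{d+2}) • borderInc d Lc M`, `M = Lc^j`).  COUNT
X-an4-39 (an4 lineage) reduces that comparison to three kernel identities; this file TYPES them, so that the count is decidable by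
`rfl`-level bookkeeping rather than by prose:
(I1) **STENCIL-INDEX SWAP** (§1–§2, NEW): for any decaying fine kernel `K`, any bounded level-`M` stencil family `G`, `N′ = M·Lc`,
  `vertexOfK K N′ (borderSum M G) = M^{d+2} • vertexOfK (dec M K) Lc (avgLift M ∘ G)` (`vertexOfK_borderSum`), where
  `borderSum M G κ u := Σ_{s<M} avgLift M (G κ (quo M (u − s e_κ)))` is the generic form of `borderInc` (`borderInc_eq_borderSum`, `rfl`);
  with `vertexOfK_avgLift` (the `K`-vertex of a lifted family is the lift of the `K`-vertex) and `vertexOfK_KInv` this is, for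
  Bałaban's sockets, `vertexOf (N := Lc^{j+1}) (borderInc d Lc (Lc^j)) = (Lc^j)^{d+2} • avgLift (Lc^j) (vertexOfK (KInvStep Lc j) Lc
  (mfNeg ∘ vhS d Lc))` (`vertexOf_borderInc`).  MECHANISM: the fine stencil index `u` and the contour step `s < M` re-index bijectively
  as (level-`M` bond `z′`, leg index `i ∈ LegIdx d M`) with `u = legPt M (inl κ) z′ i`; the `ℋ`-weights then sum over the `M^{d+2}` legs
  of one level-`M` bond with weight ONE each, which is `M^{d+2}` times the MEAN weight `legW = M^{−(d+2)}` of `dec` — the same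
  `M^{d+2}` as in `BalabanCompositeJets.respStep_eq` / `ResolventComposition.KInvStep_inl_inr`.
(I2) **ADJOINTNESS AT THE BUBBLE / HESSIAN-KERNEL LEVEL** (§3, an2's `InterLevelTransport` §5 lemmas `tadpole_avgLift` and
  `dec_comp_avgLift_comp` BY NAME, plus an2's associativity bricks `KernelWard.comp_assoc_bdb`, `BalabanStepJetsSucc.biLoc_comp_right`):
  `bubble K (avgLift M V) (avgLift M W) = bubble (dec M K) V W` (`bubble_avgLift`) and hence
  `hessKer K (avgLift M ∘ V) (avgLift M ∘ W) = hessKer (dec M K) V W` (`hessKer_avgLift`; Bałaban sockets: `hessKer_KInv_avgLift`,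
  `dec (Lc^j) (KInv (Lc^{j+1})) = KInvStep Lc j` by `rfl`) — NO scalar: lifted step-level vertices pair with the composite covariance
  exactly as the unlifted ones pair with the decimated covariance (an2's DESIGN (D-μ), `InterLevelTransport` module docstring «USE»).
(I3) the multiplier–multiplier reading `BalabanStepJetsSucc.mmRead_eq_dec` is an2's, BY NAME (not restated).
READING (bookkeeping, not a theorem about `Sstep`): by (I1) the border piece `(cVH·M^{d+2}) • borderInc d Lc M` of `Sc_succ` has the
one-shot vertex `cVH·M^{2(d+2)} • avgLift M (vertexOfK (KInvStep Lc j) Lc (mfNeg ∘ vhS d Lc))`, and by (I2) two such lifted vertices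
give the step-level bubble `cVH²·M^{4(d+2)} · bubble (KInvStep Lc j) (…) (…)` — the arithmetic of X-an4-39 §6–§7 starts here; which
weights Bałaban's step jets carry is decided where they are instantiated and by the step recursion (R1), not in this file.

CONTENT.  §1 `legPt_inl_eq`, `LegIdx_eq_product`, **`tsum_mul_contourSum`** (scalar core of (I1): a decaying weight against the
`M`-contour sum of a bounded coarse function re-indexes as the leg sum of the weight against the function —
`KKTFluctuationEnergy.tsum_shift` + `tsum_blocks` + `quo_zsmul_add_toSite`), `pow_mul_colH_dec` (`M^{d+2} · colH (dec M K) Lc = ` the leg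
sum of `colH K (M·Lc)`).  §2 `borderSum`, `borderInc_eq_borderSum`, `abs_avgLift_le`, **`vertexOfK_borderSum`**, `avgLift_finset_sum`,
`avgLift_wsum`, **`vertexOfK_avgLift`**, **`vertexOf_borderInc`**.  §3 `decays_zero_of_biLoc`, **`bubble_avgLift`**, **`hessKer_avgLift`**,
`hessKer_KInv_avgLift`.  §4 `vertexOf_smul`, **`vertexOf_borderPiece`** (the weighted border summand of `Sc_succ` has one-shot vertex
`cVH·M^{d+2}·M^{d+2} • avgLift M (weight-one (V-H) step vertex)`), **`bubble_borderPiece`** (its self-bubble through `KInv (Lc^{j+1})` =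
`(cVH·M^{2(d+2)})² ·` the step-level bubble through `KInvStep Lc j`).  §5 (v1.1) `avgLift_smul`, `vertexOfK_smul`,
**`vertexOf_borderPiece_eq_step`**, **`bubble_borderPiece_eq_step`**: with `BalabanStepJetsSucc` v1.2's weight `wVH d Lc j = ((Lc:ℝ)^j)^(2*(d+2))`
the one-shot vertex of the weighted border piece IS the averaging lift of the step vertex of the (V-H) summand `(cVH * wVH d Lc j) • mfNeg ∘ vhS`
of `Sstep j`, and the two (V-H)⊗(V-H) bubbles are EQUAL — the (V-H) column of (P6′) as a kernel identity (nothing about (E‴)/(Λ) or (R1)).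
§6 (v1.2) **`tstepOf_eq_lifted`** (for ANY step-`j` jet datum `J : JetData d Lc`, the resolvent Hessian kernel of the `(j+1)`-fold packed
resolvent `KInv (N := Lc^(j+1))` with the `avgLift (Lc^j)`-LIFTED step vertex families `avgLift (Lc^j) ∘ vertexOfK (KInvStep Lc j) Lc J.S`
and `avgLift (Lc^j) ∘ J.W` IS `OneStepKernelFamily.TstepOf Lc j J` — (I2) at the level of the wall's own kernel constructor, no scalar, no
choice of jets), `hessKer_KInv_lifted_eq_tstepOf` (the same as an equality of kernels), **`tbalOf_eq_hessKer_KInv_lifted`** (the one-step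
FAMILY member `OneStepKernelFamily.TbalOf Lc Js j`, `d + 1 = 4`, rewritten as that one-shot Hessian kernel — so `secondMoment (TbalOf Lc Js j)`,
the (1.22) read-out of the wall statement `D1Drift`, may be read through `KInv (Lc^(j+1))` by `rw`).
General `d`, `M`, `Lc`; absolute convergence from the stated decay / boundedness hypotheses only.
-/

open Finset
open scoped BigOperators
open Literature.MathematicalPhysics.QuantumFieldTheory
open Literature.MathematicalPhysics.QuantumFieldTheory.Balaban1983to89
open Literature.MathematicalPhysics.QuantumFieldTheory.Balaban1983to89.Beta
open Literature.Probability.LatticeModels (Torus.proj)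
open LatticeForm (quo)
open B12Sec2to5 (l1 l1_nonneg)
open ExpKernelCalculus (MKer Decays BiLoc VertexFamily VertexFamily₂ comp tr bubble tadpole hessKer summable_exp_shift'
  biLoc_comp_decays)
open OneStepResolventKernel (Fib LocStencil vertexOf KInv decays_KInv biLoc_mono decays_mono wsum)
open OneStepKernelFamily (legSet legPt legW LegIdx dec sum_legW legW_nonneg decays_dec colH abs_colH_le vertexOfK vertexOfK_KInv
  KInvStep decays_KInvStep vertexFamily_vertexOfK')
open InterLevelTransport (avgLift legOff biLoc_avgLift tadpole_avgLift dec_comp_avgLift_comp)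
open KernelWard (comp_assoc_bdb bdd_of_biLoc)
open KernelReflection (bubble_smul_left bubble_smul_right)
open BalabanStepJetsSucc (biLoc_comp_right wVH)
open KKTFluctuationEnergy (tsum_blocks summable_blocks tsum_shift summable_shift quo_zsmul_add_toSite)
open AffineAveraging (box toSite)
open BalabanCompositeJets (bshift borderInc)
open StepJetData (mfNeg locStencil_mfNeg)
open AveragingHessianKernels (vhS locStencil_vhS ell)

noncomputable section

namespace Literature.MathematicalPhysics.QuantumFieldTheory.Balaban1983to89.Beta.DecLiftAdjoint

variable {d : ℕ}

/-! ## §1 The stencil-index swap, scalar core -/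

section Core

/-- [folklore] A field-leg point spelled with the box offset and the contour shift:
`legPt M (inl κ) y (b, s) = M•y + toSite b + bshift d κ s`. -/
theorem legPt_inl_eq (M : ℕ) (κ : Fin (d + 1)) (y : Fin (d + 1) → ℤ) (i : (Fin (d + 1) → ℕ) × ℕ) :
    legPt M (Sum.inl κ : Fib d) y i = (M : ℤ) • y + toSite i.1 + bshift d κ i.2 := by
  funext j
  simp only [legPt, toSite, bshift, Pi.add_apply, Pi.smul_apply, smul_eq_mul]
  ring

/-- [folklore] The field-leg index set is the product of the offset box and the contour steps. -/
theorem LegIdx_eq_product (d M : ℕ) : LegIdx d M = box (d + 1) M ×ˢ Finset.range M := rfl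

/-- [folklore] **THE STENCIL-INDEX SWAP (scalar core).**  For a weight `c` decaying from some point and a bounded function `A`
on the `M`-coarse lattice, the weighted sum over the fine points `u` of the `M`-CONTOUR SUM `Σ_{s<M} A (quo M (u − s e_κ))`
(the level-`M` bonds whose straight `κ`-contour passes through `u`) is the sum over the level-`M` bonds `y` of `A y` times the
LEG SUM of the weight over the `M^{d+2}` fine points `legPt M (inl κ) y i`, `i ∈ LegIdx d M`, of that bond's contour family —
the bijection `(u, s) ↔ (y, (b, s))`, `u = M•y + b + s e_κ` (shift by `s e_κ`, then block regrouping
`KKTFluctuationEnergy.tsum_blocks`).  Absolute convergence from the decay of `c` and the boundedness of `A`. -/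
theorem tsum_mul_contourSum {c A : (Fin (d + 1) → ℤ) → ℝ} {C δ CA : ℝ} {p : Fin (d + 1) → ℤ}
    (hc : ∀ u, |c u| ≤ C * Real.exp (-δ * l1 (u - p))) (hδ : 0 < δ) (hA : ∀ z, |A z| ≤ CA) (M : ℕ) [NeZero M]
    (κ : Fin (d + 1)) :
    ∑' u, c u * ∑ s ∈ Finset.range M, A (quo M (u - bshift d κ s))
      = ∑' y, (∑ i ∈ LegIdx d M, c (legPt M (Sum.inl κ : Fib d) y i)) * A y := by
  classical
  -- (S1) summability of each shifted term
  have S1 : ∀ s : ℕ, Summable fun u => c u * A (quo M (u - bshift d κ s)) := fun s => by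
    refine Summable.of_norm_bounded (((summable_exp_shift' hδ p).mul_left C).mul_right CA) (fun u => ?_)
    rw [Real.norm_eq_abs, abs_mul]
    exact mul_le_mul (hc u) (hA _) (abs_nonneg _) ((abs_nonneg _).trans (hc u))
  -- (S2) after the shift `u = v + s e_κ`
  have S2 : ∀ s : ℕ, Summable fun v => c (v + bshift d κ s) * A (quo M v) := fun s => by
    have h := summable_shift (S1 s) (bshift d κ s)
    simpa only [add_sub_cancel_right] using h
  -- (S3) the block-regrouped coarse family
  have S3 : ∀ s : ℕ, Summable fun y => (∑ b ∈ box (d + 1) M, c ((M : ℤ) • y + toSite b + bshift d κ s)) * A y :=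
    fun s => by
    have h := summable_blocks (N := M) (S2 s)
    refine h.congr (fun y => ?_)
    rw [Finset.sum_mul]
    refine Finset.sum_congr rfl (fun b hb => ?_)
    rw [quo_zsmul_add_toSite y hb]
  -- the shift, per contour step
  have Hshift : ∀ s : ℕ, ∑' u, c u * A (quo M (u - bshift d κ s)) = ∑' v, c (v + bshift d κ s) * A (quo M v) := fun s => by
    have h := tsum_shift (fun u => c u * A (quo M (u - bshift d κ s))) (bshift d κ s)
    simp only [add_sub_cancel_right] at h
    exact h.symm
  -- the block regrouping, per contour step
  have Hblock : ∀ s : ℕ, ∑' v, c (v + bshift d κ s) * A (quo M v)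
      = ∑' y, (∑ b ∈ box (d + 1) M, c ((M : ℤ) • y + toSite b + bshift d κ s)) * A y := fun s => by
    rw [tsum_blocks (N := M) (S2 s)]
    refine tsum_congr (fun y => ?_)
    rw [Finset.sum_mul]
    refine Finset.sum_congr rfl (fun b hb => ?_)
    rw [quo_zsmul_add_toSite y hb]
  calc ∑' u, c u * ∑ s ∈ Finset.range M, A (quo M (u - bshift d κ s))
      = ∑' u, ∑ s ∈ Finset.range M, c u * A (quo M (u - bshift d κ s)) :=
        tsum_congr (fun u => Finset.mul_sum _ _ _)
    _ = ∑ s ∈ Finset.range M, ∑' u, c u * A (quo M (u - bshift d κ s)) :=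
        Summable.tsum_finsetSum (fun s _ => S1 s)
    _ = ∑ s ∈ Finset.range M, ∑' y, (∑ b ∈ box (d + 1) M, c ((M : ℤ) • y + toSite b + bshift d κ s)) * A y :=
        Finset.sum_congr rfl (fun s _ => by rw [Hshift s, Hblock s])
    _ = ∑' y, ∑ s ∈ Finset.range M, (∑ b ∈ box (d + 1) M, c ((M : ℤ) • y + toSite b + bshift d κ s)) * A y :=
        (Summable.tsum_finsetSum (fun s _ => S3 s)).symm
    _ = ∑' y, (∑ i ∈ LegIdx d M, c (legPt M (Sum.inl κ : Fib d) y i)) * A y := by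
        refine tsum_congr (fun y => ?_)
        rw [← Finset.sum_mul, LegIdx_eq_product, Finset.sum_product_right]
        congr 1
        refine Finset.sum_congr rfl (fun s _ => Finset.sum_congr rfl (fun b _ => ?_))
        rw [legPt_inl_eq]

/-- [folklore] The multiplier-leg point ignores the leg index: `legPt M (inr μ) x′ i = M•x′`. -/
theorem legPt_inr (M : ℕ) (μ : Fin (d + 1)) (x' : Fin (d + 1) → ℤ) (i : (Fin (d + 1) → ℕ) × ℕ) :
    legPt M (Sum.inr μ : Fib d) x' i = (M : ℤ) • x' := rfl

/-- [folklore] **THE `ℋ`-COLUMN OF A DECIMATED KERNEL IS THE MEAN OF THE FINE COLUMN OVER THE LEGS**: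
`M^{d+2} · colH (dec M K) Lc μ y κ z = Σ_{i ∈ LegIdx d M} colH K (M·Lc) μ y κ (legPt M (inl κ) z i)` — field leg averaged with the
mean weight `legW = M^{−(d+2)}`, multiplier leg read at `M•(Lc•y) = (M·Lc)•y` with weight `1`. -/
theorem pow_mul_colH_dec (M Lc : ℕ) [NeZero M] (K : MKer (d + 1) (Fib d)) (μ : Fin (d + 1)) (y : Fin (d + 1) → ℤ)
    (κ : Fin (d + 1)) (z : Fin (d + 1) → ℤ) :
    ((M : ℝ) ^ (d + 2)) * colH (dec M K) Lc μ y κ z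
      = ∑ i ∈ LegIdx d M, colH K (M * Lc) μ y κ (legPt M (Sum.inl κ : Fib d) z i) := by
  have hM : ((M : ℝ) ^ (d + 2)) ≠ 0 := pow_ne_zero _ (by exact_mod_cast NeZero.ne M)
  have hpt : ((M : ℤ) • ((Lc : ℤ) • y) : Fin (d + 1) → ℤ) = (((M * Lc : ℕ) : ℤ)) • y := by
    rw [smul_smul, Nat.cast_mul]
  simp only [colH, dec, legSet, legW, legPt_inr, Finset.sum_singleton, mul_one, Finset.mul_sum, hpt]
  refine Finset.sum_congr rfl (fun i _ => ?_)
  rw [← mul_assoc, mul_inv_cancel₀ hM, one_mul]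

end Core

/-! ## §2 The stencil-index swap at the vertex level -/

section Vertex

/-- [folklore] **THE `M`-CONTOUR SUM OF A LIFTED LEVEL-`M` STENCIL FAMILY** (generic form of `BalabanCompositeJets.borderInc`):
for the fine bond `(κ, u)`, the sum over the `M` level-`M` bonds `(κ, quo M (u − s e_κ))`, `s < M`, whose straight contour passes
through `(κ, u)`, of the level-`M` kernel `G κ ·` pulled back to the fine legs by `avgLift M`. -/
def borderSum (M : ℕ) (G : Fin (d + 1) → (Fin (d + 1) → ℤ) → MKer (d + 1) (Fib d)) (κ : Fin (d + 1))
    (u : Fin (d + 1) → ℤ) : MKer (d + 1) (Fib d) :=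
  fun x w a b => ∑ s ∈ Finset.range M, avgLift M (G κ (quo M (u - bshift d κ s))) x w a b

/-- [folklore] The border increment of `BalabanCompositeJets` is the instance `G κ z := mfNeg (vhS d Lc κ z)`. -/
theorem borderInc_eq_borderSum (Lc M : ℕ) :
    borderInc d Lc M = borderSum M (fun κ z => mfNeg (vhS d Lc κ z)) := rfl

/-- [folklore] The averaging lift of a bounded kernel is bounded by the same constant (the leg weights are normalised). -/
theorem abs_avgLift_le (M : ℕ) [NeZero M] {G : MKer (d + 1) (Fib d)} {CG : ℝ} (hG : ∀ x w a b, |G x w a b| ≤ CG)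
    (x w : Fin (d + 1) → ℤ) (a b : Fib d) : |avgLift M G x w a b| ≤ CG := by
  have hCG : 0 ≤ CG := (abs_nonneg _).trans (hG 0 0 a b)
  have ha := sum_legW (NeZero.ne M) a
  have hb := sum_legW (NeZero.ne M) b
  rw [Finset.sum_const, nsmul_eq_mul] at ha hb
  unfold avgLift
  refine (Finset.abs_sum_le_sum_abs _ _).trans ?_
  refine (Finset.sum_le_sum fun i _ => (Finset.abs_sum_le_sum_abs _ _).trans
    (Finset.sum_le_sum fun i' _ => (?_ : _ ≤ legW d M a * legW d M b * CG))).trans ?_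
  · rw [abs_mul, abs_of_nonneg (mul_nonneg (legW_nonneg M a) (legW_nonneg M b))]
    refine mul_le_mul_of_nonneg_left ?_ (mul_nonneg (legW_nonneg M a) (legW_nonneg M b))
    split_ifs
    · exact hG _ _ _ _
    · rw [abs_zero]; exact hCG
  · simp only [Finset.sum_const, nsmul_eq_mul]
    calc ((legSet d M a).card : ℝ) * (((legSet d M b).card : ℝ) * (legW d M a * legW d M b * CG))
        = (((legSet d M a).card : ℝ) * legW d M a) * ((((legSet d M b).card : ℝ)) * legW d M b) * CG := by ring
      _ = CG := by rw [ha, hb, one_mul, one_mul]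
    exact le_rfl

/-- [folklore] **THE STENCIL-INDEX SWAP AT THE VERTEX LEVEL.**  For a decaying fine kernel `K`, a bounded level-`M` stencil family
`G` and `N′ = M·Lc`: the chain-rule vertex THROUGH `K` (its `ℋ`-column at blocking `N′`) of the `M`-contour-summed lifted family is
`M^{d+2}` times the chain-rule vertex THROUGH `dec M K` (blocking `Lc` on the level-`M` lattice) of the lifted family:
`vertexOfK K N′ (borderSum M G) μ y = M^{d+2} • vertexOfK (dec M K) Lc (avgLift M ∘ G) μ y`.  The factor is (I1)'s: the
`ℋ`-weights of one level-`M` bond are summed over its `M^{d+2}` contour legs with weight one (`tsum_mul_contourSum`), i.e. `M^{d+2}`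
times the mean-weight column of `dec M K` (`pow_mul_colH_dec`). -/
theorem vertexOfK_borderSum {K : MKer (d + 1) (Fib d)} {C δ : ℝ} (hK : Decays K C δ) (hδ : 0 < δ)
    {G : Fin (d + 1) → (Fin (d + 1) → ℤ) → MKer (d + 1) (Fib d)} {CG : ℝ} (hG : ∀ κ z x w a b, |G κ z x w a b| ≤ CG)
    {M Lc N' : ℕ} [NeZero M] (hN : N' = M * Lc) (μ : Fin (d + 1)) (y : Fin (d + 1) → ℤ) :
    vertexOfK K N' (borderSum M G) μ y
      = ((M : ℝ) ^ (d + 2)) • vertexOfK (dec M K) Lc (fun κ z => avgLift M (G κ z)) μ y := by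
  subst hN
  funext x w a b
  simp only [vertexOfK, wsum, borderSum, Pi.smul_apply, smul_eq_mul]
  rw [Finset.mul_sum (a := (M : ℝ) ^ (d + 2))]
  refine Finset.sum_congr rfl (fun κ' _ => ?_)
  have hc : ∀ u, |colH K (M * Lc) μ y κ' u| ≤ C * Real.exp (-δ * l1 (u - ((M * Lc : ℕ) : ℤ) • y)) :=
    fun u => abs_colH_le hK μ y κ' u
  have hA : ∀ z, |avgLift M (G κ' z) x w a b| ≤ CG := fun z => abs_avgLift_le M (hG κ' z) x w a b
  rw [tsum_mul_contourSum hc hδ hA M κ', ← tsum_mul_left]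
  exact tsum_congr fun z => by rw [← mul_assoc, pow_mul_colH_dec]

/-- [folklore] The averaging lift is additive over a finite family of kernels (pointwise finite sums; unconditional). -/
theorem avgLift_finset_sum {ι : Type*} (s : Finset ι) (M : ℕ) (F : ι → MKer (d + 1) (Fib d)) :
    avgLift M (fun x w a b => ∑ k ∈ s, F k x w a b) = fun x w a b => ∑ k ∈ s, avgLift M (F k) x w a b := by
  classical
  funext x w a b
  simp only [avgLift]
  have e : ∀ (i i' : (Fin (d + 1) → ℕ) × ℕ),
      legW d M a * legW d M b *
          (if Torus.proj M (x - legOff M a i) = 0 ∧ Torus.proj M (w - legOff M b i') = 0 then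
            ∑ k ∈ s, F k (quo M (x - legOff M a i)) (quo M (w - legOff M b i')) a b else 0)
        = ∑ k ∈ s, legW d M a * legW d M b *
          (if Torus.proj M (x - legOff M a i) = 0 ∧ Torus.proj M (w - legOff M b i') = 0 then
            F k (quo M (x - legOff M a i)) (quo M (w - legOff M b i')) a b else 0) := by
    intro i i'
    split_ifs
    · rw [Finset.mul_sum]
    · simp only [mul_zero, Finset.sum_const_zero]
  simp_rw [e]
  exact (Finset.sum_congr rfl fun i _ => Finset.sum_comm).trans Finset.sum_comm

/-- [folklore] **THE AVERAGING LIFT COMMUTES WITH WEIGHTED STENCIL SUPERPOSITIONS**: `avgLift M (wsum c G) = wsum c (avgLift M ∘ G)`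
for a decaying weight `c` and a bounded family `G` (absolute convergence; the lift is a finite sum of point evaluations). -/
theorem avgLift_wsum (M : ℕ) [NeZero M] {c : (Fin (d + 1) → ℤ) → ℝ} {C δ : ℝ} {p : Fin (d + 1) → ℤ}
    (hc : ∀ u, |c u| ≤ C * Real.exp (-δ * l1 (u - p))) (hδ : 0 < δ)
    {G : (Fin (d + 1) → ℤ) → MKer (d + 1) (Fib d)} {CG : ℝ} (hG : ∀ z x w a b, |G z x w a b| ≤ CG) :
    avgLift M (wsum c G) = wsum c (fun z => avgLift M (G z)) := by
  classical
  funext x w a b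
  simp only [avgLift, wsum]
  -- the summable fine family, per pair of leg indices
  set T : ((Fin (d + 1) → ℕ) × ℕ) → ((Fin (d + 1) → ℕ) × ℕ) → (Fin (d + 1) → ℤ) → ℝ := fun i i' u =>
    legW d M a * legW d M b *
      (if Torus.proj M (x - legOff M a i) = 0 ∧ Torus.proj M (w - legOff M b i') = 0 then
        c u * G u (quo M (x - legOff M a i)) (quo M (w - legOff M b i')) a b else 0) with hT
  have hS : ∀ i i', Summable (T i i') := by
    intro i i'
    refine Summable.mul_left _ ?_
    split_ifs
    · refine Summable.of_norm_bounded (((summable_exp_shift' hδ p).mul_left C).mul_right CG) (fun u => ?_)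
      rw [Real.norm_eq_abs, abs_mul]
      exact mul_le_mul (hc u) (hG _ _ _ _ _) (abs_nonneg _) ((abs_nonneg _).trans (hc u))
    · exact summable_zero
  -- LHS summand = ∑' u, T i i' u
  have eL : ∀ i i', legW d M a * legW d M b *
      (if Torus.proj M (x - legOff M a i) = 0 ∧ Torus.proj M (w - legOff M b i') = 0 then
        ∑' u, c u * G u (quo M (x - legOff M a i)) (quo M (w - legOff M b i')) a b else 0) = ∑' u, T i i' u := by
    intro i i'
    simp only [hT]
    split_ifs
    · rw [tsum_mul_left]
    · simp only [mul_zero, tsum_zero]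
  -- RHS summand = ∑ i, ∑ i', T i i' u
  have eR : ∀ u, c u * ∑ i ∈ legSet d M a, ∑ i' ∈ legSet d M b, legW d M a * legW d M b *
      (if Torus.proj M (x - legOff M a i) = 0 ∧ Torus.proj M (w - legOff M b i') = 0 then
        G u (quo M (x - legOff M a i)) (quo M (w - legOff M b i')) a b else 0)
      = ∑ i ∈ legSet d M a, ∑ i' ∈ legSet d M b, T i i' u := by
    intro u
    rw [Finset.mul_sum]
    refine Finset.sum_congr rfl (fun i _ => ?_)
    rw [Finset.mul_sum]
    refine Finset.sum_congr rfl (fun i' _ => ?_)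
    simp only [hT]
    split_ifs
    · ring
    · simp only [mul_zero]
  simp_rw [eL]
  rw [show (∑' u, c u * ∑ i ∈ legSet d M a, ∑ i' ∈ legSet d M b, legW d M a * legW d M b *
      (if Torus.proj M (x - legOff M a i) = 0 ∧ Torus.proj M (w - legOff M b i') = 0 then
        G u (quo M (x - legOff M a i)) (quo M (w - legOff M b i')) a b else 0))
      = ∑' u, ∑ i ∈ legSet d M a, ∑ i' ∈ legSet d M b, T i i' u from tsum_congr eR,
    Summable.tsum_finsetSum (fun i _ => summable_sum fun i' _ => hS i i')]
  exact Finset.sum_congr rfl fun i _ => (Summable.tsum_finsetSum (fun i' _ => hS i i')).symm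

/-- [folklore] **THE `K`-VERTEX OF A LIFTED STENCIL FAMILY IS THE LIFT OF THE `K`-VERTEX**: for a decaying `K` and a bounded family
`G` on the coarser lattice, `vertexOfK K N (avgLift M ∘ G) μ y = avgLift M (vertexOfK K N G μ y)`. -/
theorem vertexOfK_avgLift {K : MKer (d + 1) (Fib d)} {C δ : ℝ} (hK : Decays K C δ) (hδ : 0 < δ) (N M : ℕ) [NeZero M]
    {G : Fin (d + 1) → (Fin (d + 1) → ℤ) → MKer (d + 1) (Fib d)} {CG : ℝ} (hG : ∀ κ z x w a b, |G κ z x w a b| ≤ CG)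
    (μ : Fin (d + 1)) (y : Fin (d + 1) → ℤ) :
    vertexOfK K N (fun κ z => avgLift M (G κ z)) μ y = avgLift M (vertexOfK K N G μ y) := by
  have h1 : vertexOfK K N G μ y = fun x w a b => ∑ κ' ∈ Finset.univ, wsum (colH K N μ y κ') (G κ') x w a b := by
    funext x w a b; rfl
  rw [h1, avgLift_finset_sum]
  funext x w a b
  simp only [vertexOfK]
  refine Finset.sum_congr rfl (fun κ' _ => ?_)
  rw [avgLift_wsum M (fun u => abs_colH_le hK μ y κ' u) hδ (hG κ')]

/-- [folklore] **(I1) FOR BAŁABAN'S SOCKETS**: the level-`(j+1)` one-shot chain-rule vertex (weights `ℋ_{Lc^{j+1}}`) of the border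
increment `borderInc d Lc (Lc^j)` of `BalabanCompositeJets.Sc_succ` IS `(Lc^j)^{d+2}` times the averaging lift of the step-`j`
chain-rule vertex through the decimated composite resolvent `KInvStep Lc j` of the one-step field–multiplier stencil family
`mfNeg ∘ vhS d Lc` on the step-`j` lattice:
`vertexOf (N := Lc^{j+1}) (borderInc d Lc (Lc^j)) μ y = (Lc^j)^{d+2} • avgLift (Lc^j) (vertexOfK (KInvStep Lc j) Lc (mfNeg ∘ vhS d Lc) μ y)`.
(`vertexOfK_KInv`, `borderInc_eq_borderSum`, `vertexOfK_borderSum`, `vertexOfK_avgLift`; `KInvStep Lc j = dec (Lc^j) (KInv (Lc^{j+1}))`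
by `rfl`.) -/
theorem vertexOf_borderInc {Lc : ℕ} [NeZero Lc] (hLc : 1 ≤ Lc) (j : ℕ) (μ : Fin (d + 1)) (y : Fin (d + 1) → ℤ) :
    vertexOf (N := Lc ^ (j + 1)) (borderInc d Lc (Lc ^ j)) μ y
      = (((Lc : ℝ) ^ j) ^ (d + 2)) •
        avgLift (Lc ^ j) (vertexOfK (KInvStep (d := d) Lc j) Lc (fun κ z => mfNeg (vhS d Lc κ z)) μ y) := by
  obtain ⟨δ, C, hδ, _, hK⟩ := decays_KInv (N := Lc ^ (j + 1)) (d := d)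
  obtain ⟨δ', C', hδ', _, hK'⟩ := decays_KInvStep (d := d) (Lc := Lc) j
  have hG : ∀ (κ : Fin (d + 1)) (z x w : Fin (d + 1) → ℤ) (a b : Fib d),
      |mfNeg (vhS d Lc κ z) x w a b| ≤ 3 * (ell (d + 1) Lc : ℝ) ^ 2 := by
    intro κ z x w a b
    have h := locStencil_mfNeg (locStencil_vhS (d := d) hLc (le_refl (0 : ℝ))) κ z x w a b
    simp only [mul_zero, neg_zero, zero_mul, Real.exp_zero, mul_one] at h
    exact h
  rw [← vertexOfK_KInv, borderInc_eq_borderSum, vertexOfK_borderSum hK hδ hG (pow_succ Lc j) μ y,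
    show dec (Lc ^ j) (KInv (N := Lc ^ (j + 1)) (d := d)) = KInvStep Lc j from rfl,
    vertexOfK_avgLift hK' hδ' Lc (Lc ^ j) hG μ y, Nat.cast_pow]

end Vertex

/-! ## §3 Adjointness at the bubble and the Hessian-kernel level -/

section Bubble

/-- [folklore] A bi-localised kernel is a rate-`0` decaying (= bounded) kernel with the same constant. -/
theorem decays_zero_of_biLoc {K : MKer (d + 1) (Fib d)} {p q : Fin (d + 1) → ℤ} {C δ : ℝ} (h : BiLoc K p q C δ)
    (hδ : 0 ≤ δ) : Decays K C 0 := by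
  intro x y a b
  rw [neg_zero, zero_mul, Real.exp_zero, mul_one]
  exact bdd_of_biLoc h hδ x y a b

/-- [folklore] **ADJOINTNESS OF DECIMATION AND AVERAGING LIFT AT THE BUBBLE LEVEL**:
`Tr[K (Q′ᵀVQ′) K (Q′ᵀWQ′)] = Tr[(Q′KQ′ᵀ) V (Q′KQ′ᵀ) W]`, i.e. `bubble K (avgLift M V) (avgLift M W) = bubble (dec M K) V W` for a
decaying fine kernel `K` and bi-localised coarse kernels `V`, `W` — an2's `InterLevelTransport.tadpole_avgLift` (adjointness at the
tadpole level) and `dec_comp_avgLift_comp` (the sandwich identity) BY NAME, glued by the associativity of composition under product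
majorants (`KernelWard.comp_assoc_bdb`) on both lattices.  No scalar factor. -/
theorem bubble_avgLift (M : ℕ) [NeZero M] {K V W : MKer (d + 1) (Fib d)} {CK δK CV CW δ : ℝ} {p q : Fin (d + 1) → ℤ}
    (hK : Decays K CK δK) (hδK : 0 < δK) (hV : BiLoc V p p CV δ) (hW : BiLoc W q q CW δ) (hδ : 0 < δ) :
    bubble K (avgLift M V) (avgLift M W) = bubble (dec M K) V W := by
  have hM1 : 1 ≤ M := Nat.one_le_iff_ne_zero.2 (NeZero.ne M)
  have hMr : (0 : ℝ) < M := by exact_mod_cast Nat.pos_of_ne_zero (NeZero.ne M)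
  have hCK : 0 ≤ CK := hK.nonneg (Sum.inl 0)
  have hCV : 0 ≤ CV := hV.nonneg (Sum.inl 0)
  have hCW : 0 ≤ CW := hW.nonneg (Sum.inl 0)
  -- the lifted vertices (rate `δ/M` in fine units) and a common fine rate `m`
  have hAV := biLoc_avgLift M hV hδ.le
  have hAW := biLoc_avgLift M hW hδ.le
  have hδM : 0 < δ / M := div_pos hδ hMr
  set m : ℝ := min δK (δ / M) with hm
  have hm0 : 0 < m := lt_min hδK hδM
  have hKm : Decays K CK m := decays_mono hK hCK le_rfl (min_le_left _ _)
  have hAVm := biLoc_mono hAV (by positivity) (min_le_right δK (δ / M))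
  have hAWm := biLoc_mono hAW (by positivity) (min_le_right δK (δ / M))
  -- fine side: `(K·AV)·(K·AW) = ((K·AV)·K)·AW`
  have hP := biLoc_comp_decays hKm hAVm (by positivity : (0 : ℝ) ≤ m / 2) (by linarith : m / 2 < m)
  have hKe : Decays K CK (m / 2) := decays_mono hKm hCK le_rfl (by linarith)
  have hAWe := biLoc_mono hAWm (by positivity) (by linarith : m / 2 ≤ m)
  have hP2 := biLoc_comp_right hP hKe (by positivity : (0 : ℝ) ≤ m / 4) (by linarith : m / 4 < m / 2)
  -- coarse side: `(DK·V)·(DK·W) = ((DK·V)·DK)·W`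
  have hDK := decays_dec hK hCK hδK.le hM1
  set m' : ℝ := min δK δ with hm'
  have hm'0 : 0 < m' := lt_min hδK hδ
  have hDKm := decays_mono hDK (by positivity) le_rfl (min_le_left δK δ)
  have hVm := biLoc_mono hV hCV (min_le_right δK δ)
  have hQ := biLoc_comp_decays hDKm hVm (by positivity : (0 : ℝ) ≤ m' / 2) (by linarith : m' / 2 < m')
  have hDKe := decays_mono hDK (by positivity) le_rfl (by linarith [min_le_left δK δ] : m' / 2 ≤ δK)
  have hWe := biLoc_mono hW hCW (by linarith [min_le_right δK δ] : m' / 2 ≤ δ)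
  unfold bubble
  rw [comp_assoc_bdb hP hKe hAWe (by positivity), comp_assoc_bdb hQ hDKe hWe (by positivity)]
  -- now both sides are tadpoles
  show tadpole (comp (comp K (avgLift M V)) K) (avgLift M W) = tadpole (comp (comp (dec M K) V) (dec M K)) W
  rw [tadpole_avgLift M (decays_zero_of_biLoc hP2 (by positivity)) le_rfl hW hδ,
    dec_comp_avgLift_comp M hK hδK.le hK hδK.le hV hδ]

/-- [folklore] **THE INTER-LEVEL HESSIAN-KERNEL IDENTITY, WITHOUT SCALARS**: for a decaying fine kernel `K` and vertex families
`V`, `W` on the coarser lattice, the resolvent Hessian kernel of `K` with the LIFTED families equals that of the DECIMATED kernel with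
the families themselves: `hessKer K (avgLift M ∘ V) (avgLift M ∘ W) = hessKer (dec M K) V W` (`tadpole_avgLift` + `bubble_avgLift`).
This is DESIGN (D-μ) of an2's `InterLevelTransport` («a step-`j` jet … enters as `avgLift (Lc^j) (·)`, and the two identities turn the
resulting fine-level tadpoles / bubbles into step-level ones against the DECIMATED covariance») at the level of the whole kernel. -/
theorem hessKer_avgLift (M : ℕ) [NeZero M] {K : MKer (d + 1) (Fib d)} {CK δK : ℝ} (hK : Decays K CK δK) (hδK : 0 < δK)
    {V : Fin (d + 1) → (Fin (d + 1) → ℤ) → MKer (d + 1) (Fib d)} {N : ℕ} {CV δ : ℝ} (hV : VertexFamily V N CV δ)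
    {W : Fin (d + 1) → (Fin (d + 1) → ℤ) → Fin (d + 1) → (Fin (d + 1) → ℤ) → MKer (d + 1) (Fib d)} {CW : ℝ}
    (hW : VertexFamily₂ W N CW δ) (hδ : 0 < δ) (μ ν : Fin (d + 1)) (z : Fin (d + 1) → ℤ) :
    hessKer K (fun μ y => avgLift M (V μ y)) (fun μ y ν z => avgLift M (W μ y ν z)) μ ν z = hessKer (dec M K) V W μ ν z := by
  simp only [hessKer]
  rw [bubble_avgLift M hK hδK (hV μ 0) (hV ν z) hδ, tadpole_avgLift M hK hδK.le (hW μ 0 ν z) hδ]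

/-- [folklore] **FOR BAŁABAN'S SOCKETS**: step-`j` vertex families LIFTED by `avgLift (Lc^j)` against the `(j+1)`-fold composite
packed resolvent `KInv (N := Lc^{j+1})` give EXACTLY the resolvent Hessian kernel of the decimated composite resolvent `KInvStep Lc j`
with the unlifted families — no power of `Lc`. -/
theorem hessKer_KInv_avgLift {Lc : ℕ} [NeZero Lc] (j : ℕ)
    {V : Fin (d + 1) → (Fin (d + 1) → ℤ) → MKer (d + 1) (Fib d)} {N : ℕ} {CV δ : ℝ} (hV : VertexFamily V N CV δ)
    {W : Fin (d + 1) → (Fin (d + 1) → ℤ) → Fin (d + 1) → (Fin (d + 1) → ℤ) → MKer (d + 1) (Fib d)} {CW : ℝ}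
    (hW : VertexFamily₂ W N CW δ) (hδ : 0 < δ) (μ ν : Fin (d + 1)) (z : Fin (d + 1) → ℤ) :
    hessKer (KInv (N := Lc ^ (j + 1)) (d := d)) (fun μ y => avgLift (Lc ^ j) (V μ y))
        (fun μ y ν z => avgLift (Lc ^ j) (W μ y ν z)) μ ν z
      = hessKer (KInvStep (d := d) Lc j) V W μ ν z := by
  obtain ⟨δK, CK, hδK, _, hK⟩ := decays_KInv (N := Lc ^ (j + 1)) (d := d)
  exact hessKer_avgLift (Lc ^ j) hK hδK hV hW hδ μ ν z

end Bubble

/-! ## §4 The weighted border piece of `Sc_succ`: its one-shot vertex and its self-bubble, powers of `M = Lc^j` explicit -/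

section BorderPiece

/-- [folklore] The one-shot chain-rule vertex is linear in the stencil family: a scalar weight factors out (pointwise
`tsum_mul_left`; unconditional). -/
theorem vertexOf_smul {N : ℕ} [NeZero N] (c : ℝ) (S : Fin (d + 1) → (Fin (d + 1) → ℤ) → MKer (d + 1) (Fib d))
    (μ : Fin (d + 1)) (y : Fin (d + 1) → ℤ) :
    vertexOf (N := N) (fun κ u => c • S κ u) μ y = c • vertexOf (N := N) S μ y := by
  funext x w a b
  simp only [vertexOf, wsum, Pi.smul_apply, smul_eq_mul]
  rw [Finset.mul_sum]
  refine Finset.sum_congr rfl (fun κ' _ => ?_)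
  rw [← tsum_mul_left]
  exact tsum_congr fun u => by ring

/-- [folklore] **THE WEIGHTED BORDER PIECE OF `Sc_succ` HAS ONE-SHOT VERTEX `cVH·M^{d+2}·M^{d+2} • (lifted weight-one step vertex)`**,
`M = Lc^j`: the border summand `(cVH * M^(d+2)) • borderInc d Lc M κ u` of `BalabanCompositeJets.Sc_succ` (stencil index `(κ,u)` fine,
one-shot blocking `Lc^(j+1)`), read through `ℋ_{Lc^{j+1}}`, is `cVH·M^{d+2}·M^{d+2}` times the averaging lift of the step-`j` chain-rule
vertex (through `KInvStep Lc j`) of the weight-one (V-H) family `mfNeg ∘ vhS d Lc` (`vertexOf_smul`, `vertexOf_borderInc`). -/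
theorem vertexOf_borderPiece {Lc : ℕ} [NeZero Lc] (hLc : 1 ≤ Lc) (cVH : ℝ) (j : ℕ) (μ : Fin (d + 1)) (y : Fin (d + 1) → ℤ) :
    vertexOf (N := Lc ^ (j + 1)) (fun κ u => (cVH * ((Lc : ℝ) ^ j) ^ (d + 2)) • borderInc d Lc (Lc ^ j) κ u) μ y
      = (cVH * ((Lc : ℝ) ^ j) ^ (d + 2) * ((Lc : ℝ) ^ j) ^ (d + 2)) •
        avgLift (Lc ^ j) (vertexOfK (KInvStep (d := d) Lc j) Lc (fun κ z => mfNeg (vhS d Lc κ z)) μ y) := by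
  rw [vertexOf_smul, vertexOf_borderInc hLc, smul_smul]

/-- [folklore] **THE SELF-BUBBLE OF THE WEIGHTED BORDER PIECE THROUGH THE `(j+1)`-FOLD PACKED RESOLVENT, POWERS EXPLICIT**: pairing two
weighted border-piece one-shot vertices through `KInv (N := Lc^(j+1))` gives `(cVH·M^{d+2}·M^{d+2})²` times the STEP-LEVEL bubble, through
`KInvStep Lc j`, of the weight-one (V-H) step vertices (`vertexOf_borderPiece`, `bubble_avgLift`, `dec (Lc^j) (KInv (Lc^(j+1))) =
KInvStep Lc j` by `rfl`).  For comparison (bookkeeping, not decided here): in the step kernel `OneStepKernelFamily.TstepOf Lc j J`,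
`J` the step-`j` Bałaban jet datum of `BalabanStepJetsSucc` (stencil family built from `Sstep j`, then axially dressed — the dressing is
linear in the stencil family), the (V-H)⊗(V-H) part of the bubble carries the factor `(cVH·w)²` with `w` the (V-H) weight of `Sstep j`;
which `w` the step recursion (R1) forces is the open item (P6′) and is NOT a theorem of this file. -/
theorem bubble_borderPiece {Lc : ℕ} [NeZero Lc] (hLc : 1 ≤ Lc) (cVH : ℝ) (j : ℕ) (μ ν : Fin (d + 1))
    (y z : Fin (d + 1) → ℤ) :
    bubble (KInv (N := Lc ^ (j + 1)) (d := d))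
        (vertexOf (N := Lc ^ (j + 1)) (fun κ u => (cVH * ((Lc : ℝ) ^ j) ^ (d + 2)) • borderInc d Lc (Lc ^ j) κ u) μ y)
        (vertexOf (N := Lc ^ (j + 1)) (fun κ u => (cVH * ((Lc : ℝ) ^ j) ^ (d + 2)) • borderInc d Lc (Lc ^ j) κ u) ν z)
      = (cVH * ((Lc : ℝ) ^ j) ^ (d + 2) * ((Lc : ℝ) ^ j) ^ (d + 2)) ^ 2 *
        bubble (KInvStep (d := d) Lc j)
          (vertexOfK (KInvStep (d := d) Lc j) Lc (fun κ z => mfNeg (vhS d Lc κ z)) μ y)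
          (vertexOfK (KInvStep (d := d) Lc j) Lc (fun κ z => mfNeg (vhS d Lc κ z)) ν z) := by
  obtain ⟨δK, CK, hδK, _, hK⟩ := decays_KInv (N := Lc ^ (j + 1)) (d := d)
  obtain ⟨Cv, δv, hδv, hV⟩ := vertexFamily_vertexOfK' (N := Lc) (decays_KInvStep (d := d) (Lc := Lc) j)
    (locStencil_mfNeg (locStencil_vhS (d := d) hLc zero_le_one)) one_pos
  rw [vertexOf_borderPiece hLc, vertexOf_borderPiece hLc, bubble_smul_left, bubble_smul_right,
    bubble_avgLift (Lc ^ j) hK hδK (hV μ y) (hV ν z) hδv,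
    show dec (Lc ^ j) (KInv (N := Lc ^ (j + 1)) (d := d)) = KInvStep Lc j from rfl]
  ring

end BorderPiece

/-! ## §5 (v1.1) The (V-H) column of (P6′) BY NAME: border piece of `Sc_succ` versus the (V-H) summand of `Sstep j` (v1.2 weights) -/

section ByName

/-- [folklore] The averaging lift is linear: a scalar factors out (finite sums; unconditional). -/
theorem avgLift_smul (M : ℕ) (c : ℝ) (G : MKer (d + 1) (Fib d)) : avgLift M (c • G) = c • avgLift M G := by
  funext x w a b
  simp only [avgLift, Pi.smul_apply, smul_eq_mul, Finset.mul_sum]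
  refine Finset.sum_congr rfl (fun i _ => Finset.sum_congr rfl (fun i' _ => ?_))
  split_ifs <;> ring

/-- [folklore] The coarse chain-rule vertex `vertexOfK` is linear in the stencil family: a scalar weight factors out (pointwise
`tsum_mul_left`; unconditional). -/
theorem vertexOfK_smul (K : MKer (d + 1) (Fib d)) (N : ℕ) (c : ℝ)
    (S : Fin (d + 1) → (Fin (d + 1) → ℤ) → MKer (d + 1) (Fib d)) (μ : Fin (d + 1)) (y : Fin (d + 1) → ℤ) :
    vertexOfK K N (fun κ u => c • S κ u) μ y = c • vertexOfK K N S μ y := by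
  funext x w a b
  simp only [vertexOfK, wsum, Pi.smul_apply, smul_eq_mul]
  rw [Finset.mul_sum]
  refine Finset.sum_congr rfl (fun κ' _ => ?_)
  rw [← tsum_mul_left]
  exact tsum_congr fun u => by ring

/-- [folklore] **THE ONE-SHOT VERTEX OF THE WEIGHTED BORDER PIECE IS THE AVERAGING LIFT OF THE STEP VERTEX OF THE (V-H) SUMMAND OF
`Sstep j`** (`BalabanStepJetsSucc` v1.2: summand `(cVH * wVH d Lc j) • mfNeg (vhS d Lc κ′ u′)`, `wVH d Lc j = ((Lc:ℝ)^j)^(2*(d+2))`):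
the scalar identity `cVH·M^{d+2}·M^{d+2} = cVH · wVH d Lc j`, `M = Lc^j`, on top of `vertexOf_borderPiece` (`vertexOfK_smul`, `avgLift_smul`). -/
theorem vertexOf_borderPiece_eq_step {Lc : ℕ} [NeZero Lc] (hLc : 1 ≤ Lc) (cVH : ℝ) (j : ℕ) (μ : Fin (d + 1))
    (y : Fin (d + 1) → ℤ) :
    vertexOf (N := Lc ^ (j + 1)) (fun κ u => (cVH * ((Lc : ℝ) ^ j) ^ (d + 2)) • borderInc d Lc (Lc ^ j) κ u) μ y
      = avgLift (Lc ^ j)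
          (vertexOfK (KInvStep (d := d) Lc j) Lc (fun κ z => (cVH * wVH d Lc j) • mfNeg (vhS d Lc κ z)) μ y) := by
  rw [vertexOf_borderPiece hLc, vertexOfK_smul, avgLift_smul]
  congr 1
  simp only [wVH]
  ring

/-- [folklore] **THE (V-H)⊗(V-H) BUBBLE: ONE-SHOT BORDER PIECE = STEP (V-H) SUMMAND, EXACTLY** (the (V-H) column of (P6′) as a kernel
identity between `BalabanCompositeJets.Sc_succ`'s border summand read through `KInv (N := Lc^(j+1))` and `BalabanStepJetsSucc.Sstep j`'s
(V-H) summand read through `KInvStep Lc j`, v1.2 weights): the two bubbles are EQUAL (`bubble_borderPiece`, `vertexOfK_smul`,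
`KernelReflection.bubble_smul_left/right`, `cVH·M^{d+2}·M^{d+2} = cVH · wVH d Lc j`).  It says nothing about the (E‴) and (Λ) columns
and nothing about the step recursion (R1). -/
theorem bubble_borderPiece_eq_step {Lc : ℕ} [NeZero Lc] (hLc : 1 ≤ Lc) (cVH : ℝ) (j : ℕ) (μ ν : Fin (d + 1))
    (y z : Fin (d + 1) → ℤ) :
    bubble (KInv (N := Lc ^ (j + 1)) (d := d))
        (vertexOf (N := Lc ^ (j + 1)) (fun κ u => (cVH * ((Lc : ℝ) ^ j) ^ (d + 2)) • borderInc d Lc (Lc ^ j) κ u) μ y)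
        (vertexOf (N := Lc ^ (j + 1)) (fun κ u => (cVH * ((Lc : ℝ) ^ j) ^ (d + 2)) • borderInc d Lc (Lc ^ j) κ u) ν z)
      = bubble (KInvStep (d := d) Lc j)
          (vertexOfK (KInvStep (d := d) Lc j) Lc (fun κ z => (cVH * wVH d Lc j) • mfNeg (vhS d Lc κ z)) μ y)
          (vertexOfK (KInvStep (d := d) Lc j) Lc (fun κ z => (cVH * wVH d Lc j) • mfNeg (vhS d Lc κ z)) ν z) := by
  rw [bubble_borderPiece hLc, vertexOfK_smul, vertexOfK_smul, bubble_smul_left, bubble_smul_right]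
  simp only [wVH]
  ring

end ByName

/-! ## §6 (v1.2) END-TO-END BY NAME: (I2) meets the wall's step-kernel constructor `OneStepKernelFamily.TstepOf` / `TbalOf` -/

section EndToEnd

/-- [folklore] **FOR ANY STEP-`j` JET DATUM, THE ONE-SHOT RESOLVENT HESSIAN KERNEL OF THE `(j+1)`-FOLD PACKED RESOLVENT WITH THE
`avgLift (Lc^j)`-LIFTED STEP VERTEX FAMILIES IS THE TYPED STEP KERNEL.**  For `J : JetData d Lc` (first-order stencil family `J.S`,
second-order vertex family `J.W`, common localisation rate `J.δ`):
`hessKer (KInv (N := Lc^(j+1))) (avgLift (Lc^j) ∘ vertexOfK (KInvStep Lc j) Lc J.S) (avgLift (Lc^j) ∘ J.W) μ ν z = TstepOf Lc j J μ ν z`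
— `OneStepKernelFamily.TstepOf Lc j J := hessKer (KInvStep Lc j) (vertexOfK (KInvStep Lc j) Lc J.S) J.W` unfolded and `hessKer_KInv_avgLift`
(§3, (I2)) applied at the common rate `min δv J.δ` of `vertexFamily_vertexOfK'` and `J.loc₂`.  NO scalar, NO choice of jets, any `d`, `Lc`,
`j`: the step-level pairing «vertices through `KInvStep Lc j`» IS the fine-level pairing «lifted vertices through `KInv (Lc^(j+1))`» at
the level of the wall's own kernel constructor (the wall statement reads `secondMoment (TbalOf Lc Js j)`, `TbalOf Lc Js j = TstepOf Lc j
(Js j)`).  This is the END-TO-END trailer of the outside reader's XREAD of v1/v1.1 (certificate C-lit2g21-6, INFO I3, scratch twin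
never proposed by the reader), folded here so that it is importable BY NAME; what it does NOT say: nothing about which jet datum is
Bałaban's, nothing about the composite one-shot jets `BalabanCompositeJets.Sc` / the telescoping predicate `D1Tel`, nothing of (R1). -/
theorem tstepOf_eq_lifted {Lc : ℕ} [NeZero Lc] (j : ℕ) (J : OneStepResolventKernel.JetData d Lc) (μ ν : Fin (d + 1))
    (z : Fin (d + 1) → ℤ) :
    hessKer (KInv (N := Lc ^ (j + 1)) (d := d))
        (fun μ y => avgLift (Lc ^ j) (vertexOfK (KInvStep (d := d) Lc j) Lc J.S μ y))
        (fun μ y ν z => avgLift (Lc ^ j) (J.W μ y ν z)) μ ν z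
      = OneStepKernelFamily.TstepOf Lc j J μ ν z := by
  obtain ⟨Cv, δv, hδv, hV⟩ := vertexFamily_vertexOfK' (N := Lc) (decays_KInvStep (d := d) (Lc := Lc) j) J.loc J.δ_pos
  have hCv : 0 ≤ Cv := (hV 0 0).nonneg (Sum.inl 0)
  have hCw : 0 ≤ J.Cw := (J.loc₂ 0 0 0 0).nonneg (Sum.inl 0)
  have hδ : 0 < min δv J.δ := lt_min hδv J.δ_pos
  have hV' : VertexFamily (vertexOfK (KInvStep (d := d) Lc j) Lc J.S) Lc Cv (min δv J.δ) :=
    fun μ' y => biLoc_mono (hV μ' y) hCv (min_le_left _ _)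
  have hW' : VertexFamily₂ J.W Lc J.Cw (min δv J.δ) :=
    fun μ' y ν' y' => biLoc_mono (J.loc₂ μ' y ν' y') hCw (min_le_right _ _)
  unfold OneStepKernelFamily.TstepOf
  exact hessKer_KInv_avgLift j hV' hW' hδ μ ν z

/-- [folklore] The same, as an EQUALITY OF KERNELS (`funext`): the one-shot resolvent Hessian kernel of the lifted step-`j` vertex
families through `KInv (N := Lc^(j+1))` `=` `OneStepKernelFamily.TstepOf Lc j J`. -/
theorem hessKer_KInv_lifted_eq_tstepOf {Lc : ℕ} [NeZero Lc] (j : ℕ) (J : OneStepResolventKernel.JetData d Lc) :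
    hessKer (KInv (N := Lc ^ (j + 1)) (d := d))
        (fun μ y => avgLift (Lc ^ j) (vertexOfK (KInvStep (d := d) Lc j) Lc J.S μ y))
        (fun μ y ν z => avgLift (Lc ^ j) (J.W μ y ν z))
      = OneStepKernelFamily.TstepOf Lc j J := by
  funext μ ν z
  exact tstepOf_eq_lifted j J μ ν z

/-- [folklore] **THE ONE-STEP FAMILY MEMBER READ THROUGH THE COMPOSITE PACKED RESOLVENT** (`d + 1 = 4`, the wall's dimension): for
ANY scale-indexed step jet data `Js : ℕ → JetData 3 Lc`, `OneStepKernelFamily.TbalOf Lc Js j` (`:= TstepOf Lc j (Js j)`, the kernel whose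
(1.22) second moments the wall statement `OneStepKernelFamily.D1Drift Lc Js N μ ν` is about) EQUALS the one-shot resolvent Hessian kernel
of `KInv (N := Lc^(j+1))` with the `avgLift (Lc^j)`-lifted step-`j` vertex families — stated in the direction that rewrites `TbalOf`
(e.g. under `secondMoment`) into the lifted one-shot form. -/
theorem tbalOf_eq_hessKer_KInv_lifted {Lc : ℕ} [NeZero Lc] (Js : ℕ → OneStepResolventKernel.JetData 3 Lc) (j : ℕ) :
    OneStepKernelFamily.TbalOf Lc Js j
      = hessKer (KInv (N := Lc ^ (j + 1)) (d := 3))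
          (fun μ y => avgLift (Lc ^ j) (vertexOfK (KInvStep (d := 3) Lc j) Lc (Js j).S μ y))
          (fun μ y ν z => avgLift (Lc ^ j) ((Js j).W μ y ν z)) :=
  (hessKer_KInv_lifted_eq_tstepOf (d := 3) j (Js j)).symm

end EndToEnd

end Literature.MathematicalPhysics.QuantumFieldTheory.Balaban1983to89.Beta.DecLiftAdjoint

end
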